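import Mathlib.AlgebraicTopology.FundamentalGroupoid.SimplyConnected
import Mathlib.Analysis.Normed.Group.Bounded
import Mathlib.Analysis.SpecialFunctions.Pow.Real
import Literature.Probability.RandomPlanarGeometry.RestrictionMeasures
import Literature.Probability.RandomPlanarGeometry.CritPercSLE
import HarnessLib

/-!
# The semigroup of `*`-hulls and the multiplicativity of the SLE_{8/3} avoidance probabilities

Level 1 of the decomposition of the named fact `Literature.Probability.RandomPlanarGeometry.LawlerSchrammWerner2003` (file
`ConformalRestriction`; plan in `ConformalRestrictionProofs`), continuing `RestrictionHulls`, after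

* G. F. Lawler, O. Schramm, W. Werner, *Conformal restriction: the chordal case*, J. Amer. Math.
  Soc. **16** (2003) 917–955, arXiv:math/0209343 (**[LSW]**, arXiv page numbers).

[LSW] §2 p. 8 ("Semigroups"): "Let `𝒜₁ = {Φ_A : A ∈ 𝒬*}`. Note that `𝒜` and `𝒜₁` are both
semigroups under composition. (Of course, the domain of `Φ₁ ∘ Φ₂` is `Φ₂⁻¹(H₁)` if `H₁` is the
domain of `Φ₁`.) We can consider `𝒬*` as a semigroup with the product `·`, where `A · A'` is
defined by `Φ_{A·A'} = Φ_A ∘ Φ_{A'}`." And in the proof of Prop. 3.3 (p. 11): "Because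
`Φ'_{A₁·A₂}(0) = Φ'_{A₁}(0) Φ'_{A₂}(0)`, 3 also implies that for all `A₁, A₂ ∈ 𝒬*`,
`P[K ∩ (A₁·A₂) = ∅] = P[K ∩ A₁ = ∅] P[K ∩ A₂ = ∅]`, which implies 1" (i.e. `𝒜₁`-covariance,
the restriction property, tested on the generating avoidance events of Lemma 3.2).

This file PROVES these statements in the vocabulary of `RestrictionHulls` and connects them to
the level-2 predicate `RestrictionConfig.IsHullProduct A A' B` of `RestrictionMeasures` ("`B` is
the product `A · A'`", through which `RestrictionConfig.IsHullMultiplicative` is stated):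

* `Literature.hullProduct A A' Φ'` — a CONSTRUCTION of the product hull `A · A'` (given a restriction
  map `Φ'` of `A'`): the closure of `(A' ∩ ℍ) ∪ {z ∈ ℍ ∖ A' | Φ'(z) ∈ A}`, so that
  `ℍ ∖ (A · A') = Φ'⁻¹(ℍ ∖ A)` (`diff_hullProduct`); it does not depend on the choice of the
  restriction map (`hullProduct_congr`), and it satisfies the predicate:
  `RestrictionConfig.isHullProduct_hullProduct` (so `IsHullProduct A A'` is inhabited for all
  `A, A' ∈ 𝒬*` once `Φ_{A'}` exists);
* `Literature.Probability.RandomPlanarGeometry.IsStarHull.hullProduct` — `A · A' ∈ 𝒬*` for `A, A' ∈ 𝒬*` (bounded because `Φ'(z)/z → 1`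
  at `∞`; away from `0` because `Φ'(0) = 0 ∉ A`; `ℍ ∖ (A·A') ≅ ℍ ∖ A` is simply connected, being
  homeomorphic to it by `Φ'`);
* `Literature.Probability.RandomPlanarGeometry.hullProductMap` and `Literature.Probability.RandomPlanarGeometry.IsRestrictionMap.hullProduct` — `Φ_A ∘ Φ_{A'}` (restricted to
  `Φ_{A'}⁻¹(ℍ ∖ A)`) is a restriction map of `A · A'`, i.e. `Φ_{A·A'} = Φ_A ∘ Φ_{A'}`;
* `Literature.Probability.RandomPlanarGeometry.HasRestrictionDeriv.hullProduct` — the chain rule `Φ'_{A·A'}(0) = Φ'_A(0) Φ'_{A'}(0)`;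
* `Literature.Probability.RandomPlanarGeometry.sle_restriction_eightThirds.measure_avoid_hullProduct` — consequence of the named fact
  [LSW] Thm. 6.1 (`sle_restriction_eightThirds`): for the SLE_{8/3} trace `γ`,
  `P[γ ∩ (A·A') = ∅] = P[γ ∩ A' = ∅] · P[γ ∩ A = ∅]` (Prop. 3.3, (3) ⇒ (1), p. 11), and its
  reading `sle_restriction_eightThirds.measure_avoid_and_comp_avoid`:
  `P[γ ∩ A' = ∅ and Φ_{A'}(γ) ∩ A = ∅] = P[γ ∩ A' = ∅] · P[γ ∩ A = ∅]`, which is the restriction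
  property of the law of `γ` with respect to `Φ_{A'}` on the avoidance events `{· ∩ A = ∅}`
  (these generate the σ-algebra, Lemma 3.2): "the law of `γ(0,∞)` is therefore `P_{5/8}`"
  (Thm. 6.1, second sentence). The identification of the event `{γ ∩ (A·A') = ∅}` uses that the
  trace is a simple path in `ℍ ∪ {0}` (Rohde–Schramm Thm. 6.1, the tree's named fact
  `CritPerc.ae_isSimpleTrace_sleTrace_of_le_four`).

Also: the homeomorphism `U ≃ₜ V` underlying a conformal equivalence and the restriction of a
conformal equivalence to a pair of corresponding subsets (`ConformalEquiv.toHomeomorph`,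
`ConformalEquiv.restr`), with the transfer of simple connectivity
(`ConformalEquiv.isSimplyConnected_iff`, Mathlib's
`ContinuousMap.HomotopyEquiv.simplyConnectedSpace_iff`).
-/

noncomputable section

open Set Filter Topology MeasureTheory Bornology
open UpperHalfPlane (upperHalfPlaneSet isOpen_upperHalfPlaneSet)
open scoped NNReal

namespace Literature.Probability.RandomPlanarGeometry

/-! ### Conformal equivalences: underlying homeomorphism, restriction -/

namespace ConformalEquiv

variable {U V : Set ℂ}

/-- The homeomorphism `U ≃ₜ V` (subtypes) underlying a conformal equivalence `U → V`. [folklore] -/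
def toHomeomorph (φ : ConformalEquiv U V) : U ≃ₜ V where
  toFun z := ⟨φ z, φ.mapsTo z.2⟩
  invFun w := ⟨φ.symm w, φ.symm_mapsTo w.2⟩
  left_inv z := Subtype.ext (φ.symm_apply_apply z.2)
  right_inv w := Subtype.ext (φ.apply_symm_apply w.2)
  continuous_toFun := φ.continuousOn.mapsToRestrict φ.mapsTo
  continuous_invFun := φ.symm.continuousOn.mapsToRestrict φ.symm_mapsTo

/-- The underlying homeomorphism is the map. [folklore] -/
@[simp] theorem coe_toHomeomorph_apply (φ : ConformalEquiv U V) (z : U) :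
    (φ.toHomeomorph z : ℂ) = φ z := rfl

/-- **Simple connectivity is a conformal invariant** (indeed a homotopy invariant; Mathlib's
`ContinuousMap.HomotopyEquiv.simplyConnectedSpace_iff` applied to the underlying homeomorphism).
[folklore] -/
theorem isSimplyConnected_iff (φ : ConformalEquiv U V) :
    IsSimplyConnected U ↔ IsSimplyConnected V :=
  φ.toHomeomorph.toHomotopyEquiv.simplyConnectedSpace_iff

/-- **Restriction of a conformal equivalence** `φ : U → V` to subsets `U' ⊆ U`, `V' ⊆ V` which
correspond under `φ` (`φ(U') ⊆ V'`, `φ⁻¹(V') ⊆ U'`): a conformal equivalence `U' → V'` with the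
same underlying maps. [folklore] -/
def restr (φ : ConformalEquiv U V) (U' V' : Set ℂ) (hU : U' ⊆ U) (hV : V' ⊆ V)
    (h : MapsTo φ U' V') (h' : MapsTo φ.symm V' U') : ConformalEquiv U' V' where
  toFun := φ
  invFun := φ.symm
  source := U'
  target := V'
  map_source' := h
  map_target' := h'
  left_inv' _ hx := φ.symm_apply_apply (hU hx)
  right_inv' _ hy := φ.apply_symm_apply (hV hy)
  source_eq := rfl
  target_eq := rfl
  differentiableOn := φ.differentiableOn.mono hU
  differentiableOn_symm := φ.symm.differentiableOn.mono hV

/-- The restriction has the same underlying map. [folklore] -/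
@[simp] theorem restr_apply (φ : ConformalEquiv U V) (U' V' : Set ℂ) (hU : U' ⊆ U)
    (hV : V' ⊆ V) (h : MapsTo φ U' V') (h' : MapsTo φ.symm V' U') (z : ℂ) :
    φ.restr U' V' hU hV h h' z = φ z := rfl

/-- The restriction has the same underlying inverse map. [folklore] -/
@[simp] theorem restr_symm_apply (φ : ConformalEquiv U V) (U' V' : Set ℂ) (hU : U' ⊆ U)
    (hV : V' ⊆ V) (h : MapsTo φ U' V') (h' : MapsTo φ.symm V' U') (w : ℂ) :
    (φ.restr U' V' hU hV h h').symm w = φ.symm w := rfl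

end ConformalEquiv

/-! ### The product of `*`-hulls ([LSW] §2 p. 8) -/

section Product

variable {A A' : Set ℂ} {Φ : ConformalEquiv (upperHalfPlaneSet \ A) upperHalfPlaneSet}
  {Φ' : ConformalEquiv (upperHalfPlaneSet \ A') upperHalfPlaneSet}

/-- The part in `ℍ` of the product hull `A · A'`: the points of `ℍ` lying in `A'` or mapped into
`A` by `Φ_{A'}`, i.e. `ℍ ∖ Φ_{A'}⁻¹(ℍ ∖ A)`. [cite: LawlerSchrammWerner2003Restriction, §2 p. 8 (Semigroups)] -/
def hullProductCore (A A' : Set ℂ)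
    (Φ' : ConformalEquiv (upperHalfPlaneSet \ A') upperHalfPlaneSet) : Set ℂ :=
  A' ∩ upperHalfPlaneSet ∪ {z | z ∈ upperHalfPlaneSet \ A' ∧ Φ' z ∈ A}

/-- **The product hull `A · A'`** ([LSW] §2 p. 8: "`𝒬*` is a semigroup with the product `·`,
where `A · A'` is defined by `Φ_{A·A'} = Φ_A ∘ Φ_{A'}`"; "the domain of `Φ₁ ∘ Φ₂` is `Φ₂⁻¹(H₁)`
if `H₁` is the domain of `Φ₁`"), given a restriction map `Φ'` of `A'`: the closure of
`(A' ∩ ℍ) ∪ {z ∈ ℍ ∖ A' | Φ'(z) ∈ A}`, so that `ℍ ∖ (A · A') = Φ'⁻¹(ℍ ∖ A)` (`diff_hullProduct`).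
This CONSTRUCTS a witness of the predicate `RestrictionConfig.IsHullProduct A A'` of
`RestrictionMeasures` (`RestrictionConfig.isHullProduct_hullProduct`); it is independent of the
choice of `Φ'` (`hullProduct_congr`). [cite: LawlerSchrammWerner2003Restriction, §2 p. 8 (Semigroups)] -/
def hullProduct (A A' : Set ℂ)
    (Φ' : ConformalEquiv (upperHalfPlaneSet \ A') upperHalfPlaneSet) : Set ℂ :=
  closure (hullProductCore A A' Φ')

/-- The core lies in `ℍ`. [folklore] -/
theorem hullProductCore_subset : hullProductCore A A' Φ' ⊆ upperHalfPlaneSet := by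
  rintro z (⟨-, hz⟩ | ⟨hz, -⟩)
  · exact hz
  · exact hz.1

/-- A point of `ℍ` is outside the core iff it is outside `A'` and `Φ'` maps it outside `A`. [folklore] -/
theorem notMem_hullProductCore_iff {z : ℂ} (hz : z ∈ upperHalfPlaneSet) :
    z ∉ hullProductCore A A' Φ' ↔ z ∉ A' ∧ Φ' z ∉ A := by
  constructor
  · intro h
    refine ⟨fun h' ↦ h (Or.inl ⟨h', hz⟩), fun h' ↦ h ?_⟩
    by_cases hzA' : z ∈ A'
    · exact Or.inl ⟨hzA', hz⟩
    · exact Or.inr ⟨⟨hz, hzA'⟩, h'⟩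
  · rintro ⟨h1, h2⟩ (⟨hzA', -⟩ | ⟨-, hzA⟩)
    · exact h1 hzA'
    · exact h2 hzA

/-- The core is contained in the product hull. [folklore] -/
theorem hullProductCore_subset_hullProduct : hullProductCore A A' Φ' ⊆ hullProduct A A' Φ' :=
  subset_closure

/-- The product hull only depends on the values of the restriction map on `ℍ ∖ A'` (so, by
the uniqueness in `IsStarHull.existsUnique_isRestrictionMap`, `A · A'` is well defined). [folklore] -/
theorem hullProduct_congr {Φ₁ Φ₂ : ConformalEquiv (upperHalfPlaneSet \ A') upperHalfPlaneSet}
    (h : EqOn Φ₁ Φ₂ (upperHalfPlaneSet \ A')) : hullProduct A A' Φ₁ = hullProduct A A' Φ₂ := by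
  have hcore : hullProductCore A A' Φ₁ = hullProductCore A A' Φ₂ := by
    ext z
    simp only [hullProductCore, mem_union, mem_setOf_eq]
    exact or_congr Iff.rfl
      ⟨fun hz ↦ ⟨hz.1, h hz.1 ▸ hz.2⟩, fun hz ↦ ⟨hz.1, (h hz.1).symm ▸ hz.2⟩⟩
  rw [hullProduct, hullProduct, hcore]

/-- `ℍ ∖ (A · A') ⊆ ℍ ∖ A'`. [folklore] -/
theorem diff_hullProduct_subset :
    upperHalfPlaneSet \ hullProduct A A' Φ' ⊆ upperHalfPlaneSet \ A' :=
  fun _ hz ↦ ⟨hz.1, fun h ↦ hz.2 (subset_closure (Or.inl ⟨h, hz.1⟩))⟩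

/-- The product hull is closed. [folklore] -/
theorem isClosed_hullProduct : IsClosed (hullProduct A A' Φ') := isClosed_closure

/-- **The part in `ℍ` of `A · A'` is the core** (`A`, `A'` closed): the core is relatively closed
in `ℍ`, because `{z ∈ ℍ ∖ A' | Φ'(z) ∈ A}` is closed in the open set `ℍ ∖ A'` by continuity of
`Φ'`. [folklore] -/
theorem hullProduct_inter (hA : IsClosed A) (hA' : IsClosed A') :
    hullProduct A A' Φ' ∩ upperHalfPlaneSet = hullProductCore A A' Φ' := by
  refine Subset.antisymm ?_ fun z hz ↦ ⟨subset_closure hz, hullProductCore_subset hz⟩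
  rintro z ⟨hzB, hz⟩
  by_contra hzc
  obtain ⟨hzA', hzA⟩ := (notMem_hullProductCore_iff hz).1 hzc
  -- near `z`, the core consists of points of `ℍ ∖ A'` mapped into `A`
  have hN : IsOpen (upperHalfPlaneSet \ A') := isOpen_upperHalfPlaneSet.sdiff hA'
  have hzN : z ∈ upperHalfPlaneSet \ A' := ⟨hz, hzA'⟩
  set T : Set ℂ := {w | w ∈ upperHalfPlaneSet \ A' ∧ Φ' w ∈ A} with hT
  have hcl : z ∈ closure T := by
    have h1 : z ∈ closure ((upperHalfPlaneSet \ A') ∩ hullProductCore A A' Φ') :=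
      hN.inter_closure ⟨hzN, hzB⟩
    refine closure_mono ?_ h1
    rintro w ⟨hwN, (⟨hwA', -⟩ | hw)⟩
    · exact absurd hwA' hwN.2
    · exact hw
  -- continuity of `Φ'` at `z` within `T ⊆ ℍ ∖ A'` and closedness of `A`
  have hTsub : T ⊆ upperHalfPlaneSet \ A' := fun w hw ↦ hw.1
  have hcont : Tendsto Φ' (𝓝[T] z) (𝓝 (Φ' z)) :=
    ((Φ'.continuousOn z hzN).mono hTsub).tendsto
  haveI : (𝓝[T] z).NeBot := mem_closure_iff_nhdsWithin_neBot.1 hcl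
  refine hzA (hA.mem_of_tendsto hcont ?_)
  exact eventually_mem_nhdsWithin.mono fun w hw ↦ hw.2

/-- **`ℍ ∖ (A · A') = Φ'⁻¹(ℍ ∖ A)`**: a point of `ℍ` is outside `A · A'` iff it is outside `A'`
and `Φ'` maps it outside `A`. [cite: LawlerSchrammWerner2003Restriction, §2 p. 8 (Semigroups)] -/
theorem notMem_hullProduct_iff (hA : IsClosed A) (hA' : IsClosed A') {z : ℂ}
    (hz : z ∈ upperHalfPlaneSet) : z ∉ hullProduct A A' Φ' ↔ z ∉ A' ∧ Φ' z ∉ A := by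
  rw [← notMem_hullProductCore_iff hz, ← hullProduct_inter hA hA']
  exact ⟨fun h h' ↦ h h'.1, fun h h' ↦ h ⟨h', hz⟩⟩

/-- Set form of `notMem_hullProduct_iff`. [folklore] -/
theorem diff_hullProduct (hA : IsClosed A) (hA' : IsClosed A') :
    upperHalfPlaneSet \ hullProduct A A' Φ' =
      {z | z ∈ upperHalfPlaneSet \ A' ∧ Φ' z ∉ A} := by
  ext z
  simp only [Set.mem_sdiff, mem_setOf_eq]
  constructor
  · rintro ⟨hz, hzB⟩
    obtain ⟨h1, h2⟩ := (notMem_hullProduct_iff hA hA' hz).1 hzB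
    exact ⟨⟨hz, h1⟩, h2⟩
  · rintro ⟨⟨hz, hzA'⟩, hzA⟩
    exact ⟨hz, (notMem_hullProduct_iff hA hA' hz).2 ⟨hzA', hzA⟩⟩

/-- `Φ'` maps `ℍ ∖ (A · A')` into `ℍ ∖ A`. [folklore] -/
theorem mapsTo_diff_hullProduct (hA : IsClosed A) (hA' : IsClosed A') :
    MapsTo Φ' (upperHalfPlaneSet \ hullProduct A A' Φ') (upperHalfPlaneSet \ A) := by
  intro z hz
  rw [diff_hullProduct hA hA'] at hz
  exact ⟨Φ'.mapsTo hz.1, hz.2⟩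

/-- `Φ'⁻¹` maps `ℍ ∖ A` into `ℍ ∖ (A · A')`. [folklore] -/
theorem symm_mapsTo_diff_hullProduct (hA : IsClosed A) (hA' : IsClosed A') :
    MapsTo Φ'.symm (upperHalfPlaneSet \ A) (upperHalfPlaneSet \ hullProduct A A' Φ') := by
  intro w hw
  rw [diff_hullProduct hA hA']
  refine ⟨Φ'.symm_mapsTo hw.1, ?_⟩
  rw [Φ'.apply_symm_apply hw.1]
  exact hw.2

/-- The restriction of `Φ_{A'}` to `ℍ ∖ (A · A') → ℍ ∖ A`. [folklore] -/
def hullProductRestr (Φ' : ConformalEquiv (upperHalfPlaneSet \ A') upperHalfPlaneSet)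
    (hA : IsClosed A) (hA' : IsClosed A') :
    ConformalEquiv (upperHalfPlaneSet \ hullProduct A A' Φ') (upperHalfPlaneSet \ A) :=
  Φ'.restr (upperHalfPlaneSet \ hullProduct A A' Φ') (upperHalfPlaneSet \ A)
    diff_hullProduct_subset sdiff_subset (mapsTo_diff_hullProduct hA hA')
    (symm_mapsTo_diff_hullProduct hA hA')

/-- **`Φ_A ∘ Φ_{A'}` on `ℍ ∖ (A · A')`**, as a conformal equivalence `ℍ ∖ (A · A') → ℍ`
([LSW] §2 p. 8: `Φ_{A·A'} = Φ_A ∘ Φ_{A'}`). [cite: LawlerSchrammWerner2003Restriction, §2 p. 8 (Semigroups)] -/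
def hullProductMap (Φ : ConformalEquiv (upperHalfPlaneSet \ A) upperHalfPlaneSet)
    (Φ' : ConformalEquiv (upperHalfPlaneSet \ A') upperHalfPlaneSet) (hA : IsClosed A)
    (hA' : IsClosed A') :
    ConformalEquiv (upperHalfPlaneSet \ hullProduct A A' Φ') upperHalfPlaneSet :=
  (hullProductRestr Φ' hA hA').trans Φ

/-- `Φ_{A·A'}(z) = Φ_A(Φ_{A'}(z))`. [folklore] -/
@[simp] theorem hullProductMap_apply (hA : IsClosed A) (hA' : IsClosed A') (z : ℂ) :
    hullProductMap Φ Φ' hA hA' z = Φ (Φ' z) := rfl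

/-! ### `A · A'` is a `*`-hull -/

/-- Points of `ℍ ∖ B` are nonzero. [folklore] -/
theorem ne_zero_of_mem_diff {B : Set ℂ} {z : ℂ} (hz : z ∈ upperHalfPlaneSet \ B) : z ≠ 0 := by
  rintro rfl
  exact absurd hz.1 (by simp [upperHalfPlaneSet])

/-- Far out in `ℍ ∖ A'`, `‖Φ'(z)‖ ≥ ‖z‖ / 2` (from `Φ'(z)/z → 1`). [folklore] -/
theorem IsRestrictionMap.eventually_norm_le (hΦ' : IsRestrictionMap A' Φ') :
    ∀ᶠ z in cocompact ℂ ⊓ 𝓟 (upperHalfPlaneSet \ A'), ‖z‖ / 2 ≤ ‖Φ' z‖ := by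
  have h1 : ∀ᶠ z in cocompact ℂ ⊓ 𝓟 (upperHalfPlaneSet \ A'), dist (Φ' z / z) 1 < 1 / 2 :=
    hΦ'.2 (Metric.ball_mem_nhds _ (by norm_num))
  have h2 : ∀ᶠ z in cocompact ℂ ⊓ 𝓟 (upperHalfPlaneSet \ A'), z ∈ upperHalfPlaneSet \ A' :=
    mem_inf_of_right (mem_principal_self _)
  filter_upwards [h1, h2] with z hz1 hz2
  have hz0 : z ≠ 0 := ne_zero_of_mem_diff hz2
  rw [dist_eq_norm] at hz1
  have h3 : 1 / 2 ≤ ‖Φ' z / z‖ := by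
    have := norm_sub_norm_le (1 : ℂ) (Φ' z / z)
    rw [norm_one, norm_sub_rev] at this
    linarith
  rw [norm_div, le_div_iff₀ (norm_pos_iff.2 hz0)] at h3
  linarith

/-- **A restriction map tends to `∞` at `∞`** (`Φ'(z)/z → 1`, so `‖Φ'(z)‖ ≥ ‖z‖/2 → ∞`). [folklore] -/
theorem IsRestrictionMap.tendsto_cocompact (hΦ' : IsRestrictionMap A' Φ') :
    Tendsto Φ' (cocompact ℂ ⊓ 𝓟 (upperHalfPlaneSet \ A')) (cocompact ℂ) := by
  have hn : Tendsto (fun z : ℂ ↦ ‖z‖ / 2) (cocompact ℂ ⊓ 𝓟 (upperHalfPlaneSet \ A')) atTop :=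
    (tendsto_norm_cocompact_atTop.mono_left inf_le_left).atTop_div_const (by norm_num)
  have h : Tendsto (fun z ↦ ‖Φ' z‖) (cocompact ℂ ⊓ 𝓟 (upperHalfPlaneSet \ A')) atTop :=
    tendsto_atTop_mono' _ hΦ'.eventually_norm_le hn
  rw [← Metric.cobounded_eq_cocompact (α := ℂ)] at h ⊢
  exact tendsto_norm_atTop_iff_cobounded.1 h

/-- The core of the product of a bounded `A` with an `A'` whose restriction map is asymptotic to
the identity at `∞` is bounded: far out, `‖Φ'(z)‖ ≥ ‖z‖/2` exceeds the size of `A`. [folklore] -/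
theorem isBounded_hullProductCore (hA : IsBounded A) (hA' : IsBounded A')
    (hΦ' : IsRestrictionMap A' Φ') : IsBounded (hullProductCore A A' Φ') := by
  obtain ⟨R, hR⟩ := hA.subset_closedBall 0
  have hev := hΦ'.eventually_norm_le
  rw [Filter.eventually_inf_principal, ← Metric.cobounded_eq_cocompact] at hev
  obtain ⟨r, -, hr⟩ := (Filter.hasBasis_cobounded_norm.eventually_iff).1 hev
  -- the core lies in the closed ball of radius `max r (2 * R)` union `A'`
  refine ((Metric.isBounded_closedBall (x := (0 : ℂ)) (r := max r (2 * R))).union hA').subset ?_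
  rintro z (⟨hzA', -⟩ | ⟨hzN, hzA⟩)
  · exact Or.inr hzA'
  · left
    rw [Metric.mem_closedBall, dist_zero_right]
    by_contra hlt
    push Not at hlt
    have hrz : r ≤ ‖z‖ := (le_max_left _ _).trans hlt.le
    have h2 : ‖z‖ / 2 ≤ ‖Φ' z‖ := hr hrz hzN
    have h4 : ‖Φ' z‖ ≤ R := by simpa using hR hzA
    have : 2 * R < ‖z‖ := (le_max_right _ _).trans_lt hlt
    linarith

/-- The origin is not in the product hull: `A'` is closed off `0`, and near `0` the map `Φ'`
(boundary value `0`) takes values close to `0`, outside the closed set `A ∌ 0`. [folklore] -/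
theorem zero_notMem_hullProduct (hA : IsClosed A) (h0A : (0 : ℂ) ∉ A) (hA' : IsClosed A')
    (h0A' : (0 : ℂ) ∉ A') (hΦ' : IsRestrictionMap A' Φ') : (0 : ℂ) ∉ hullProduct A A' Φ' := by
  have hAc : Aᶜ ∈ 𝓝 (0 : ℂ) := hA.isOpen_compl.mem_nhds h0A
  have h1 : ∀ᶠ z in 𝓝[upperHalfPlaneSet \ A'] 0, Φ' z ∈ Aᶜ := hΦ'.1 hAc
  rw [eventually_nhdsWithin_iff] at h1
  have h2 : ∀ᶠ z in 𝓝 (0 : ℂ), z ∉ A' := hA'.isOpen_compl.mem_nhds h0A'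
  have h3 : ∀ᶠ z in 𝓝 (0 : ℂ), z ∉ hullProductCore A A' Φ' := by
    filter_upwards [h1, h2] with z hz1 hz2
    rintro (⟨hzA', -⟩ | ⟨hzN, hzA⟩)
    · exact hz2 hzA'
    · exact hz1 hzN hzA
  intro h0
  rw [hullProduct, mem_closure_iff_nhds] at h0
  obtain ⟨w, hw, hw'⟩ := h0 _ h3
  exact hw hw'

/-- **`𝒬*` is closed under the product** ([LSW] §2 p. 8: "`𝒜₁` is a semigroup under
composition"): for `*`-hulls `A`, `A'` and a restriction map `Φ'` of `A'`, `A · A'` is a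
`*`-hull. Bounded by `isBounded_hullProductCore`; equal to the closure of its part in `ℍ` by
construction; `ℍ ∖ (A · A') = Φ'⁻¹(ℍ ∖ A)` is conformally equivalent, hence homeomorphic, to the
simply connected `ℍ ∖ A`; and `0 ∉ A · A'`. [cite: LawlerSchrammWerner2003Restriction, §2 p. 8 (Semigroups)] -/
theorem IsStarHull.hullProduct (hA : IsStarHull A) (hA' : IsStarHull A')
    (hΦ' : IsRestrictionMap A' Φ') : IsStarHull (hullProduct A A' Φ') := by
  have hAc : IsClosed A := hA.isBoundedHull.isClosed
  have hA'c : IsClosed A' := hA'.isBoundedHull.isClosed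
  refine ⟨⟨?_, ?_, ?_⟩, zero_notMem_hullProduct hAc hA.zero_notMem hA'c hA'.zero_notMem hΦ'⟩
  · exact (isBounded_hullProductCore hA.isBoundedHull.1 hA'.isBoundedHull.1 hΦ').closure
  · rw [hullProduct_inter hAc hA'c, _root_.Literature.Probability.RandomPlanarGeometry.hullProduct]
  · exact (hullProductRestr Φ' hAc hA'c).isSimplyConnected_iff.2 hA.isBoundedHull.2.2

/-- **Bridge to `RestrictionMeasures`**: the constructed `hullProduct A A' Φ'` IS the product
`A · A'` in the sense of the predicate `RestrictionConfig.IsHullProduct` (`B ∈ 𝒬*` with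
`ℍ ∖ B = Φ_{A'}⁻¹(ℍ ∖ A)`); in particular that predicate is inhabited for all `A, A' ∈ 𝒬*`.
[cite: LawlerSchrammWerner2003Restriction, §2 p. 8 (Semigroups)] -/
theorem RestrictionConfig.isHullProduct_hullProduct (hA : IsStarHull A) (hA' : IsStarHull A')
    (hΦ' : IsRestrictionMap A' Φ') :
    RestrictionConfig.IsHullProduct A A' (_root_.Literature.Probability.RandomPlanarGeometry.hullProduct A A' Φ') :=
  ⟨hA.hullProduct hA' hΦ', Φ', hΦ',
    diff_hullProduct hA.isBoundedHull.isClosed hA'.isBoundedHull.isClosed⟩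

/-! ### `Φ_{A·A'} = Φ_A ∘ Φ_{A'}` and the chain rule -/

/-- `Φ'` tends to `0` within `ℍ ∖ A` along `𝓝[ℍ ∖ (A·A')] 0`. [folklore] -/
theorem tendsto_nhdsWithin_diff_hullProduct (hA : IsClosed A) (hA' : IsClosed A')
    (hΦ' : IsRestrictionMap A' Φ') :
    Tendsto Φ' (𝓝[upperHalfPlaneSet \ hullProduct A A' Φ'] 0)
      (𝓝[upperHalfPlaneSet \ A] 0) := by
  refine tendsto_nhdsWithin_iff.2 ⟨hΦ'.1.mono_left (nhdsWithin_mono _ diff_hullProduct_subset), ?_⟩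
  exact eventually_mem_nhdsWithin.mono fun z hz ↦ mapsTo_diff_hullProduct hA hA' hz

/-- `Φ'` tends to `∞` within `ℍ ∖ A` as `z → ∞` within `ℍ ∖ (A·A')` (`Φ'(z)/z → 1`). [folklore] -/
theorem tendsto_cocompact_diff_hullProduct (hA : IsClosed A) (hA' : IsClosed A')
    (hΦ' : IsRestrictionMap A' Φ') :
    Tendsto Φ' (cocompact ℂ ⊓ 𝓟 (upperHalfPlaneSet \ hullProduct A A' Φ'))
      (cocompact ℂ ⊓ 𝓟 (upperHalfPlaneSet \ A)) := by
  have hle : cocompact ℂ ⊓ 𝓟 (upperHalfPlaneSet \ hullProduct A A' Φ') ≤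
      cocompact ℂ ⊓ 𝓟 (upperHalfPlaneSet \ A') :=
    inf_le_inf_left _ (principal_mono.2 diff_hullProduct_subset)
  refine tendsto_inf.2 ⟨hΦ'.tendsto_cocompact.mono_left hle, tendsto_principal.2 ?_⟩
  · have hev : ∀ᶠ z in cocompact ℂ ⊓ 𝓟 (upperHalfPlaneSet \ hullProduct A A' Φ'),
        z ∈ upperHalfPlaneSet \ hullProduct A A' Φ' :=
      mem_inf_of_right (mem_principal_self _)
    exact hev.mono fun z hz ↦ mapsTo_diff_hullProduct hA hA' hz

/-- **`Φ_{A·A'} = Φ_A ∘ Φ_{A'}`** ([LSW] §2 p. 8): the composite is a restriction map of the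
product hull — it fixes `0` (composition of boundary values) and `Φ_A(Φ_{A'}(z))/z =
(Φ_A(w)/w)(Φ_{A'}(z)/z) → 1` at `∞`, `w = Φ_{A'}(z) → ∞`. [cite: LawlerSchrammWerner2003Restriction, §2 p. 8 (Semigroups)] -/
theorem IsRestrictionMap.hullProduct (hA : IsClosed A) (hA' : IsClosed A')
    (hΦ : IsRestrictionMap A Φ) (hΦ' : IsRestrictionMap A' Φ') :
    IsRestrictionMap (_root_.Literature.Probability.RandomPlanarGeometry.hullProduct A A' Φ') (hullProductMap Φ Φ' hA hA') := by
  refine ⟨?_, ?_⟩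
  · -- boundary value `0` at `0`
    change Tendsto (fun z ↦ Φ (Φ' z)) _ _
    exact hΦ.1.comp (tendsto_nhdsWithin_diff_hullProduct hA hA' hΦ')
  · change Tendsto (fun z ↦ Φ (Φ' z) / z) _ _
    have h1 : Tendsto (fun z ↦ Φ (Φ' z) / Φ' z)
        (cocompact ℂ ⊓ 𝓟 (upperHalfPlaneSet \ _root_.Literature.Probability.RandomPlanarGeometry.hullProduct A A' Φ')) (𝓝 1) :=
      hΦ.2.comp (tendsto_cocompact_diff_hullProduct hA hA' hΦ')
    have h2 : Tendsto (fun z ↦ Φ' z / z)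
        (cocompact ℂ ⊓ 𝓟 (upperHalfPlaneSet \ _root_.Literature.Probability.RandomPlanarGeometry.hullProduct A A' Φ')) (𝓝 1) :=
      hΦ'.2.mono_left (inf_le_inf_left _ (principal_mono.2 diff_hullProduct_subset))
    have h3 := h1.mul h2
    rw [mul_one] at h3
    refine h3.congr' ?_
    have hev : ∀ᶠ z in cocompact ℂ ⊓ 𝓟 (upperHalfPlaneSet \ _root_.Literature.Probability.RandomPlanarGeometry.hullProduct A A' Φ'),
        z ∈ upperHalfPlaneSet \ _root_.Literature.Probability.RandomPlanarGeometry.hullProduct A A' Φ' :=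
      mem_inf_of_right (mem_principal_self _)
    filter_upwards [hev] with z hz
    have hw : Φ' z ≠ 0 := ne_zero_of_mem_diff (mapsTo_diff_hullProduct hA hA' hz)
    exact div_mul_div_cancel₀ hw

/-- **Chain rule `Φ'_{A·A'}(0) = Φ'_A(0) · Φ'_{A'}(0)`** ([LSW] proof of Prop. 3.3, p. 11):
`Φ_A(Φ_{A'}(z))/z = (Φ_A(w)/w)(Φ_{A'}(z)/z)` with `w = Φ_{A'}(z) → 0` inside `ℍ ∖ A` as `z → 0`
inside `ℍ ∖ (A·A')`. [cite: LawlerSchrammWerner2003Restriction, Prop. 3.3 proof (p. 11)] -/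
theorem HasRestrictionDeriv.hullProduct (hA : IsClosed A) (hA' : IsClosed A')
    (hΦ' : IsRestrictionMap A' Φ') {d d' : ℝ} (hd : HasRestrictionDeriv A Φ d)
    (hd' : HasRestrictionDeriv A' Φ' d') :
    HasRestrictionDeriv (_root_.Literature.Probability.RandomPlanarGeometry.hullProduct A A' Φ') (hullProductMap Φ Φ' hA hA')
      (d * d') := by
  change Tendsto (fun z ↦ Φ (Φ' z) / z) _ _
  have h1 : Tendsto (fun z ↦ Φ (Φ' z) / Φ' z)
      (𝓝[upperHalfPlaneSet \ _root_.Literature.Probability.RandomPlanarGeometry.hullProduct A A' Φ'] 0) (𝓝 (d : ℂ)) :=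
    hd.comp (tendsto_nhdsWithin_diff_hullProduct hA hA' hΦ')
  have h2 : Tendsto (fun z ↦ Φ' z / z)
      (𝓝[upperHalfPlaneSet \ _root_.Literature.Probability.RandomPlanarGeometry.hullProduct A A' Φ'] 0) (𝓝 (d' : ℂ)) :=
    hd'.mono_left (nhdsWithin_mono _ diff_hullProduct_subset)
  have h3 := h1.mul h2
  rw [show ((d : ℂ) * (d' : ℂ)) = ((d * d' : ℝ) : ℂ) by push_cast; ring] at h3
  refine h3.congr' ?_
  filter_upwards [self_mem_nhdsWithin] with z hz
  have hw : Φ' z ≠ 0 := ne_zero_of_mem_diff (mapsTo_diff_hullProduct hA hA' hz)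
  exact div_mul_div_cancel₀ hw

/-- With [LSW] (2.4) (`IsStarHull.exists_hasRestrictionDeriv`, hypothesis `hex`), every value of
`Φ'_A(0)` in the sense of `HasRestrictionDeriv` is positive (uniqueness of the limit). [folklore] -/
theorem HasRestrictionDeriv.pos (hex : IsStarHull.exists_hasRestrictionDeriv) (hA : IsStarHull A)
    (hΦ : IsRestrictionMap A Φ) {d : ℝ} (hd : HasRestrictionDeriv A Φ d) : 0 < d := by
  obtain ⟨d₀, h0, -, hd₀⟩ := hex hA hΦ
  rwa [hd.unique hA hd₀]

end Product

/-! ### Multiplicativity of the SLE_{8/3} avoidance probabilities ([LSW] Thm. 6.1 ⇒ Prop. 3.3 (1)) -/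

section SLE

variable {A A' : Set ℂ} {Φ : ConformalEquiv (upperHalfPlaneSet \ A) upperHalfPlaneSet}
  {Φ' : ConformalEquiv (upperHalfPlaneSet \ A') upperHalfPlaneSet}

/-- For a path `γ` in `ℍ ∪ {0}` from `0` (`γ(0) = 0`, `γ(t) ∈ ℍ` for `t > 0`) and closed `A`,
`A' ∌ 0` with `0 ∉ A · A'`: `γ` avoids `A · A'` iff it avoids `A'` and `Φ_{A'} ∘ γ` avoids `A`
on `(0, ∞)`. [folklore] -/
theorem disjoint_range_hullProduct_iff (hA : IsClosed A) (hA' : IsClosed A')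
    (h0A' : (0 : ℂ) ∉ A') (h0B : (0 : ℂ) ∉ hullProduct A A' Φ') {γ : ℝ≥0 → ℂ} (h0 : γ 0 = 0)
    (hγ : ∀ t, 0 < t → 0 < (γ t).im) :
    Disjoint (range γ) (hullProduct A A' Φ') ↔
      Disjoint (range γ) A' ∧ ∀ t, 0 < t → Φ' (γ t) ∉ A := by
  simp only [Set.disjoint_left, mem_range, forall_exists_index, forall_apply_eq_imp_iff]
  constructor
  · intro h
    refine ⟨fun t htA' ↦ ?_, fun t ht hΦt ↦ ?_⟩
    · rcases eq_or_ne t 0 with rfl | ht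
      · exact h0A' (h0 ▸ htA')
      · exact h t (subset_closure (Or.inl ⟨htA', hγ t (pos_iff_ne_zero.2 ht)⟩))
    · by_cases htA' : γ t ∈ A'
      · exact h t (subset_closure (Or.inl ⟨htA', hγ t ht⟩))
      · exact h t (subset_closure (Or.inr ⟨⟨hγ t ht, htA'⟩, hΦt⟩))
  · rintro ⟨h1, h2⟩ t htB
    rcases eq_or_ne t 0 with rfl | ht
    · exact h0B (h0 ▸ htB)
    · have ht' : 0 < t := pos_iff_ne_zero.2 ht
      exact ((notMem_hullProduct_iff hA hA' (hγ t ht')).2 ⟨h1 t, h2 t ht'⟩) htB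

/-- **Multiplicativity of the SLE_{8/3} avoidance probabilities** — [LSW] Thm. 6.1 (p. 23,
named fact `sle_restriction_eightThirds`) combined with the chain rule
`Φ'_{A·A'}(0) = Φ'_A(0) Φ'_{A'}(0)` exactly as in the proof of Prop. 3.3, (3) ⇒ (1) (p. 11:
"`P[K ∩ (A₁·A₂) = ∅] = P[K ∩ A₁ = ∅] P[K ∩ A₂ = ∅]`, which implies 1"): for `*`-hulls `A, A'`
with restriction maps `Φ_A, Φ_{A'}` and the SLE_{8/3} trace `γ`,
`P[γ ∩ (A·A') = ∅] = P[γ ∩ A' = ∅] · P[γ ∩ A = ∅]`. Further hypothesis: [LSW] (2.4) (`hex`,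
positivity of `Φ'_A(0)`, so that `(d d')^{5/8} = d^{5/8} d'^{5/8}` in `ℝ≥0∞`).
[cite: LawlerSchrammWerner2003Restriction, Thm. 6.1 (p. 23) with Prop. 3.3 (3) ⇒ (1) (p. 11)] -/
theorem sle_restriction_eightThirds.measure_avoid_hullProduct (h61 : sle_restriction_eightThirds)
    (hex : IsStarHull.exists_hasRestrictionDeriv) (hA : IsStarHull A) (hA' : IsStarHull A')
    (hΦ : IsRestrictionMap A Φ) (hΦ' : IsRestrictionMap A' Φ') :
    Process.preWienerMeasure {ω | Disjoint (range (sleTrace ((8 : ℝ≥0) / 3) ω)) (hullProduct A A' Φ')} =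
      Process.preWienerMeasure {ω | Disjoint (range (sleTrace ((8 : ℝ≥0) / 3) ω)) A'} *
        Process.preWienerMeasure {ω | Disjoint (range (sleTrace ((8 : ℝ≥0) / 3) ω)) A} := by
  have hAc : IsClosed A := hA.isBoundedHull.isClosed
  have hA'c : IsClosed A' := hA'.isBoundedHull.isClosed
  obtain ⟨d, hd0, -, hd⟩ := hex hA hΦ
  obtain ⟨d', hd0', -, hd'⟩ := hex hA' hΦ'
  have hB : IsStarHull (hullProduct A A' Φ') := hA.hullProduct hA' hΦ'
  have hBΦ : IsRestrictionMap (hullProduct A A' Φ') (hullProductMap Φ Φ' hAc hA'c) :=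
    hΦ.hullProduct hAc hA'c hΦ'
  have hBd : HasRestrictionDeriv (hullProduct A A' Φ') (hullProductMap Φ Φ' hAc hA'c) (d * d') :=
    hd.hullProduct hAc hA'c hΦ' hd'
  rw [h61 hB hBΦ hBd, h61 hA hΦ hd, h61 hA' hΦ' hd', Real.mul_rpow hd0.le hd0'.le,
    ENNReal.ofReal_mul (Real.rpow_nonneg hd0.le _), mul_comm]

/-- **The restriction property of SLE_{8/3} under `Φ_{A'}` on the generating events**: for
`*`-hulls `A, A'` and the SLE_{8/3} trace `γ`,
`P[γ ∩ A' = ∅ and Φ_{A'}(γ(0,∞)) ∩ A = ∅] = P[γ ∩ A' = ∅] · P[γ ∩ A = ∅]` — i.e. conditionally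
on `{γ ∩ A' = ∅}`, `Φ_{A'}(γ)` avoids `A` with the probability that `γ` does ("the law of
`γ(0,∞)` is therefore `P_{5/8}`", [LSW] Thm. 6.1 second sentence, on the events `{· ∩ A = ∅}`
which generate the σ-algebra by Lemma 3.2). From `measure_avoid_hullProduct`, the event being
a.s. `{γ ∩ (A·A') = ∅}` because the trace is a simple path in `ℍ ∪ {0}` (Rohde–Schramm
Thm. 6.1, hypothesis `h₆`). [cite: LawlerSchrammWerner2003Restriction, Thm. 6.1 (p. 23), second sentence] -/
theorem sle_restriction_eightThirds.measure_avoid_and_comp_avoid (h61 : sle_restriction_eightThirds)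
    (hex : IsStarHull.exists_hasRestrictionDeriv)
    (h₆ : RandomPlanarGeometry.ae_isSimpleTrace_sleTrace_of_le_four (κ := (8 : ℝ≥0) / 3))
    (hA : IsStarHull A) (hA' : IsStarHull A') (hΦ : IsRestrictionMap A Φ)
    (hΦ' : IsRestrictionMap A' Φ') :
    Process.preWienerMeasure {ω | Disjoint (range (sleTrace ((8 : ℝ≥0) / 3) ω)) A' ∧
        ∀ t, 0 < t → Φ' (sleTrace ((8 : ℝ≥0) / 3) ω t) ∉ A} =
      Process.preWienerMeasure {ω | Disjoint (range (sleTrace ((8 : ℝ≥0) / 3) ω)) A'} *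
        Process.preWienerMeasure {ω | Disjoint (range (sleTrace ((8 : ℝ≥0) / 3) ω)) A} := by
  have hAc : IsClosed A := hA.isBoundedHull.isClosed
  have hA'c : IsClosed A' := hA'.isBoundedHull.isClosed
  have hB : IsStarHull (hullProduct A A' Φ') := hA.hullProduct hA' hΦ'
  -- the event is a.s. the avoidance event of the product hull
  have hκ0 : (0 : ℝ≥0) < 8 / 3 := by positivity
  have hκ4 : (8 : ℝ≥0) / 3 ≤ 4 := by
    rw [div_le_iff₀ (by norm_num : (0 : ℝ≥0) < 3)]
    norm_num
  have hae : {ω | Disjoint (range (sleTrace ((8 : ℝ≥0) / 3) ω)) A' ∧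
      ∀ t, 0 < t → Φ' (sleTrace ((8 : ℝ≥0) / 3) ω t) ∉ A} =ᵐ[Process.preWienerMeasure]
      {ω | Disjoint (range (sleTrace ((8 : ℝ≥0) / 3) ω)) (hullProduct A A' Φ')} := by
    filter_upwards [h₆ hκ0 hκ4] with ω hω
    have h0 : sleTrace ((8 : ℝ≥0) / 3) ω 0 = 0 := by
      change Loewner.trace (sleDriving ((8 : ℝ≥0) / 3) ω) 0 = 0
      rw [Loewner.trace_zero, sleDriving_zero, Complex.ofReal_zero]
    exact propext
      (disjoint_range_hullProduct_iff hAc hA'c hA'.zero_notMem hB.zero_notMem h0 hω.2).symm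
  rw [measure_congr hae, h61.measure_avoid_hullProduct hex hA hA' hΦ hΦ']

end SLE

end Literature.Probability.RandomPlanarGeometry

end
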